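import Summits.Ventures.AbcSig.Rows.TemplateCE
import Summits.Ventures.AbcSig.Levels.N256

/-!
# Venture AbcSig — ROW `XnYn2Z2`: `xⁿ + yⁿ = 2 z²` (`C = 2·1` even; GENERATED by p-lean gen3/leanrow_ce.py)

HONEST FRAMING. A row of a COMPUTATION cell (`pub-abcsig`); a CONDITIONAL theorem, no claim on ABC or any summit.
Hypotheses: `BS04Package` (CITED: [BS04] Lemma 3.3 + (3.1) + Lemma 4.2), `DataComplete` at the level 256 = 2⁸·1²
(COMPUTED, certified level file), and the listed per-orbit exclusions `hX_…` (CITED; the row of record's R5 names the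
printed argument / module for each). Everything else is kernel-checked (`Rows/TemplateCE.lean`, `Levels/N256.lean`).
Exponent range: prime `n ≥ 7`; `x·y ≠ ±1`.
Row of record: `census/rows/C1/C1-C2-all.md` (sha256 `3b95c32b9110cbd9…`; SIGNED 2026-08-22T09:55:38Z by referee (); its R0: THEOREM (uses CITED arithmetic facts) for all primes n >= 7 with n coprime to 2 — class: REPRODUCTION of BS04 Thm 1.1, C = 2 (prime n ≥ 7); two engine. [BS04, Thm 1.1] C = 2 (REPRODUCTION): the four rational CM orbits of 256 are excluded by [BS04, Prop. 4.6] as printed (CITED hypotheses here); the fifth orbit is sieved in the kernel. Level 256 = 2⁸·1.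
-/

namespace Summit.Ventures.AbcSig

/-- Row `XnYn2Z2`: no primitive solution of `xⁿ + yⁿ = 2 z²` with `x·y ≠ ±1` for prime `n ≥ 7`,
conditional on the named hypotheses. -/
theorem row_XnYn2Z2 (M : NewformModel) (hP : M.BS04Package)
    (hD256 : M.DataComplete 256 level256Orbits)
    (n : ℕ) (hn : n.Prime) (hmin : 7 ≤ n)
    (hX_orbit_256_1 : M.Excludes 256 orbit_256_1 (fun S => S.A = 1 ∧ S.B = 1 ∧ S.C = 2 ∧ S.n = n))
    (hX_orbit_256_2 : M.Excludes 256 orbit_256_2 (fun S => S.A = 1 ∧ S.B = 1 ∧ S.C = 2 ∧ S.n = n))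
    (hX_orbit_256_3 : M.Excludes 256 orbit_256_3 (fun S => S.A = 1 ∧ S.B = 1 ∧ S.C = 2 ∧ S.n = n))
    (hX_orbit_256_4 : M.Excludes 256 orbit_256_4 (fun S => S.A = 1 ∧ S.B = 1 ∧ S.C = 2 ∧ S.n = n))
    (a b c : ℤ) (hxy1 : a * b ≠ 1) (hxy2 : a * b ≠ -1) : ¬ IsPrimitiveSolution 1 1 2 n a b c := by
  have h7 : 7 ≤ n := by omega
  have hsq : Squarefree (1 : ℕ) := squarefree_one
  have hnC : ¬ n ∣ 1 := by
    intro h; have := Nat.le_of_dvd one_pos h; omega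
  exact row_template_evenC 2 1 (by norm_num) hsq (by decide) M hP hD256 n hn h7 hnC
    (level256_sieve n hn h7 (fun o => M.Excludes 256 o
      (fun S => S.A = 1 ∧ S.B = 1 ∧ S.C = 2 ∧ S.n = n)) hX_orbit_256_1 hX_orbit_256_2 hX_orbit_256_3 hX_orbit_256_4)
    a b c hxy1 hxy2

end Summit.Ventures.AbcSig
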